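import Mathlib
import Literature.Geometry.Symplectic.JHolomorphicMap
import Literature.Topology.PlaneTopology.WindingNumber
import Summits.SmoothPoincare4.SmoothPoincare4.Theorems.SullivanDualTameOrBrodyR4HelperPairDichotomy
import Summits.SmoothPoincare4.SmoothPoincare4.Theorems.SullivanDualTameOrBrodyR4HelperZerosPersist
import Summits.SmoothPoincare4.SmoothPoincare4.Theorems.SullivanDualTameOrBrodyR4HelperPerturbedIdentityInverse
import Summits.SmoothPoincare4.SmoothPoincare4.Theorems.SullivanDualTameOrBrodyR4HelperComposeC1Convergence

/-!
# Persistence of intersections: sheets of a limit of injective curves coincide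

Crux `TameOrBrodyR4` (stmt-SmoothPoincare4-7826), line `Sketch`, skeleton v16 — stub
`helper_pairCoincideOfApprox` (PL2), companion of `…HelperPairDichotomy.lean` (PL1, whose
`namespace PairDichotomy` supplies the adapted-coordinate description of the two sheets and the
local dichotomy "`c ≡ 0` near `ξb` or `ξb` is an isolated zero of `c` with non-zero winding
number", `c = (Λ ∘ v).2` the normal coordinate of the second sheet).

If the immersed `J`-holomorphic curve `v` is the `C¹_loc`-limit of INJECTIVE smooth curves `u n`
and `ξa ≠ ξb`, `v ξa = v ξb`, the isolated alternative is impossible, so the sheets coincide: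
on a small closed disc `K₁` about `ξa` (where `Λ ∘ v` is the inclusion `ζ ↦ (ζ, 0)`) the maps
`P_n := (Λ ∘ u n).1` are `C¹`-close to the identity (`helper_composeC1Convergence`), hence have
continuous right inverses `g_n` on the quarter disc (`helper_perturbedIdentityInverse`) — the
first sheet of `u n` is a graph over the `z`-axis; on `K₂ := closedBall ξb ε` the functions
`d_n ζ := Q_n ζ - Q_n (g_n (P_n ζ))` (`Q_n := (Λ ∘ u n).2`) are continuous and converge to `c`
uniformly on the circle, so by `helper_zerosPersist` some `d_n` vanishes at some `z ∈ K₂`; with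
`ζ' := g_n (P_n z) ∈ K₁` this says `Λ (u n z) = Λ (u n ζ')`, hence `u n z = u n ζ'` (`Λ` is
injective near `x₀`), hence `z = ζ'` by injectivity of `u n` — impossible since `K₁ ∩ K₂ = ∅`.

Reference: M. Gromov, *Pseudo holomorphic curves in symplectic manifolds*, Invent. Math. 82
(1985), 2.3; D. McDuff, D. Salamon, *J-holomorphic curves and symplectic topology*, 2nd ed.
(2012), §2.6 and App. E (positivity / persistence of intersections of `J`-curves).
-/

set_option linter.dupNamespace false

noncomputable section

open Filter Set Metric Literature.Geometry.Symplectic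
open scoped ContDiff Topology

namespace Summit.SmoothPoincare4.SmoothPoincare4.Cruxes.TameOrBrodyR4.Sketch

/-- Local notation for the model space `ℝ⁴ = EuclideanSpace ℝ (Fin 4)`. -/
local notation "E4" => EuclideanSpace ℝ (Fin 4)

namespace PairCoincide

open PairDichotomy

/-! ### Persistence: the first sheet of the approximants is a graph -/

/-- On a closed disc `K₁ = closedBall ξa r₁` on which `Λ ∘ v` is the inclusion `ζ ↦ (ζ, 0)` of
the `z`-axis, the first coordinate `P_n := (Λ ∘ u n).1` of the approximants is eventually
`C¹`-close to the identity, hence (quantitative inverse function theorem) has a continuous right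
inverse `g` on the quarter disc with values in `K₁`; and eventually `u n '' K₁ ⊆ U`. -/
theorem eventually_graph {Λ : E4 → ℂ × ℂ} {U : Set E4} (hU : IsOpen U)
    (hΛ : ContDiffOn ℝ ∞ Λ U) {u : ℕ → ℂ → E4} {v : ℂ → E4} (hu : ∀ n, ContDiff ℝ ∞ (u n))
    (hv : ContDiff ℝ ∞ v) (hloc : TendstoLocallyUniformly u v atTop)
    (hdloc : TendstoLocallyUniformly (fun n => fderiv ℝ (u n)) (fderiv ℝ v) atTop)
    {ξa : ℂ} {r₁ : ℝ} (hr₁ : 0 < r₁) (hKU : ∀ ζ ∈ closedBall ξa r₁, v ζ ∈ U)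
    (hflat : ∀ ζ ∈ closedBall ξa r₁,
      (fun ζ => Λ (v ζ)) =ᶠ[𝓝 ζ] ⇑(ContinuousLinearMap.inl ℝ ℂ ℂ)) :
    ∀ᶠ n in atTop, (∀ ζ ∈ closedBall ξa r₁, u n ζ ∈ U) ∧
      ∃ g : ℂ → ℂ, (∀ y ∈ closedBall ξa (r₁ / 4),
          g y ∈ closedBall ξa r₁ ∧ (Λ (u n (g y))).1 = y) ∧
        ContinuousOn g (closedBall ξa (r₁ / 4)) := by
  obtain ⟨h0, h1, hU'⟩ := helper_composeC1Convergence Λ U hU hΛ u v hu hv hloc hdloc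
    (closedBall ξa r₁) (isCompact_closedBall ξa r₁) hKU
  filter_upwards [hU', Metric.tendstoUniformlyOn_iff.1 h0 (r₁ / 4) (by positivity),
    Metric.tendstoUniformlyOn_iff.1 h1 (1 / 2) one_half_pos] with n hn hn0 hn1
  refine ⟨hn, ?_⟩
  have hΛd : ∀ p ∈ U, DifferentiableAt ℝ Λ p := fun p hp =>
    (hΛ.differentiableOn (by simp)).differentiableAt (hU.mem_nhds hp)
  have hdiff : ∀ z ∈ closedBall ξa r₁, DifferentiableAt ℝ (fun ζ => Λ (u n ζ)) z :=
    fun z hz => (hΛd _ (hn z hz)).comp z ((hu n).differentiable (by simp) z)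
  -- the first coordinate `P_n` and its derivative
  have hPd : ∀ z ∈ closedBall ξa r₁, HasFDerivAt (fun ζ => (Λ (u n ζ)).1)
      (fderiv ℝ (fun ζ => (Λ (u n ζ)).1) z) z :=
    fun z hz => (hdiff z hz).fst.hasFDerivAt
  have hder : ∀ z ∈ closedBall ξa r₁,
      ‖fderiv ℝ (fun ζ => (Λ (u n ζ)).1) z - ContinuousLinearMap.id ℝ ℂ‖ ≤ 1 / 2 := by
    intro z hz
    have hA : ‖fderiv ℝ (fun ζ => Λ (u n ζ)) z - fderiv ℝ (fun ζ => Λ (v ζ)) z‖ < 1 / 2 := by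
      rw [← dist_eq_norm, dist_comm]
      exact hn1 z hz
    have hlim : fderiv ℝ (fun ζ => Λ (v ζ)) z = ContinuousLinearMap.inl ℝ ℂ ℂ := by
      rw [(hflat z hz).fderiv_eq]
      exact (ContinuousLinearMap.inl ℝ ℂ ℂ).fderiv
    refine ContinuousLinearMap.opNorm_le_bound _ (by norm_num) fun w => ?_
    have hw : (fderiv ℝ (fun ζ => (Λ (u n ζ)).1) z - ContinuousLinearMap.id ℝ ℂ) w =
        ((fderiv ℝ (fun ζ => Λ (u n ζ)) z - fderiv ℝ (fun ζ => Λ (v ζ)) z) w).1 := by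
      rw [fderiv.fst (hdiff z hz), hlim]
      simp
    rw [hw]
    exact (norm_fst_le _).trans ((ContinuousLinearMap.le_opNorm _ _).trans
      (mul_le_mul_of_nonneg_right hA.le (norm_nonneg _)))
  have hP0 : ‖(Λ (u n ξa)).1 - ξa‖ ≤ r₁ / 4 := by
    have hva : Λ (v ξa) = (ξa, 0) := by
      simpa using (hflat ξa (mem_closedBall_self hr₁.le)).eq_of_nhds
    have h := hn0 ξa (mem_closedBall_self hr₁.le)
    rw [hva, dist_comm, dist_eq_norm] at h
    calc ‖(Λ (u n ξa)).1 - ξa‖ = ‖(Λ (u n ξa) - (ξa, 0)).1‖ := by simp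
      _ ≤ ‖Λ (u n ξa) - (ξa, 0)‖ := norm_fst_le _
      _ ≤ r₁ / 4 := h.le
  obtain ⟨-, g, hg, hgl⟩ := helper_perturbedIdentityInverse (fun ζ => (Λ (u n ζ)).1)
    (fderiv ℝ (fun ζ => (Λ (u n ζ)).1)) ξa r₁ hr₁ hPd hder hP0
  refine ⟨g, hg, ?_⟩
  have hL : LipschitzOnWith 2 g (closedBall ξa (r₁ / 4)) :=
    LipschitzOnWith.of_dist_le_mul fun y hy y' hy' => by
      simpa only [dist_eq_norm, NNReal.coe_ofNat] using hgl y hy y' hy'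
  exact hL.continuousOn

/-- On the closed disc `K₂ = closedBall ξb ε` about the second parameter: `Λ ∘ u n → Λ ∘ v`
uniformly, eventually `u n '' K₂ ⊆ U`, and eventually the first coordinate `(Λ ∘ u n).1` maps
`K₂` into the quarter disc `closedBall ξa (r₁ / 4)` (because `a = (Λ ∘ v).1` maps `K₂` into
`ball ξa (r₁ / 8)`). -/
theorem eventually_sheetTwo {Λ : E4 → ℂ × ℂ} {U : Set E4} (hU : IsOpen U)
    (hΛ : ContDiffOn ℝ ∞ Λ U) {u : ℕ → ℂ → E4} {v : ℂ → E4} (hu : ∀ n, ContDiff ℝ ∞ (u n))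
    (hv : ContDiff ℝ ∞ v) (hloc : TendstoLocallyUniformly u v atTop)
    (hdloc : TendstoLocallyUniformly (fun n => fderiv ℝ (u n)) (fderiv ℝ v) atTop)
    {ξa ξb : ℂ} {ε r₁ : ℝ} (hr₁ : 0 < r₁) (hKU : ∀ ζ ∈ closedBall ξb ε, v ζ ∈ U)
    (ha : ∀ ζ ∈ closedBall ξb ε, ‖(Λ (v ζ)).1 - ξa‖ < r₁ / 8) :
    TendstoUniformlyOn (fun n ζ => Λ (u n ζ)) (fun ζ => Λ (v ζ)) atTop (closedBall ξb ε) ∧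
    ∀ᶠ n in atTop, (∀ ζ ∈ closedBall ξb ε, u n ζ ∈ U) ∧
      ∀ ζ ∈ closedBall ξb ε, (Λ (u n ζ)).1 ∈ closedBall ξa (r₁ / 4) := by
  obtain ⟨h0, -, hU'⟩ := helper_composeC1Convergence Λ U hU hΛ u v hu hv hloc hdloc
    (closedBall ξb ε) (isCompact_closedBall ξb ε) hKU
  refine ⟨h0, ?_⟩
  filter_upwards [hU', Metric.tendstoUniformlyOn_iff.1 h0 (r₁ / 8) (by positivity)]
    with n hn hn0
  refine ⟨hn, fun ζ hζ => ?_⟩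
  have h1 : ‖(Λ (u n ζ)).1 - (Λ (v ζ)).1‖ < r₁ / 8 := by
    have h := hn0 ζ hζ
    rw [dist_comm, dist_eq_norm] at h
    calc ‖(Λ (u n ζ)).1 - (Λ (v ζ)).1‖ = ‖(Λ (u n ζ) - Λ (v ζ)).1‖ := by simp
      _ ≤ ‖Λ (u n ζ) - Λ (v ζ)‖ := norm_fst_le _
      _ < r₁ / 8 := h
  rw [mem_closedBall, dist_eq_norm]
  have h2 := norm_sub_le_norm_sub_add_norm_sub (Λ (u n ζ)).1 (Λ (v ζ)).1 ξa
  linarith [ha ζ hζ]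

/-- Continuity on `K₂` of `d ζ := Q ζ - Q (g (P ζ))` (`P, Q` the coordinates of `Λ ∘ w`), from
the mapping properties `P '' K₂ ⊆ S`, `g '' S ⊆ K₁`, `w '' (K₁ ∪ K₂) ⊆ U`. -/
theorem continuousOn_d {Λ : E4 → ℂ × ℂ} {U : Set E4} (hΛc : ContinuousOn Λ U) {w : ℂ → E4}
    (hw : Continuous w) {K₁ K₂ S : Set ℂ} {g : ℂ → ℂ} (h1 : ∀ z ∈ K₁, w z ∈ U)
    (h4 : ∀ z ∈ K₂, w z ∈ U) (hgS : ∀ y ∈ S, g y ∈ K₁) (hgc : ContinuousOn g S)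
    (h5 : ∀ z ∈ K₂, (Λ (w z)).1 ∈ S) :
    ContinuousOn (fun ζ => (Λ (w ζ)).2 - (Λ (w (g ((Λ (w ζ)).1)))).2) K₂ := by
  have hK₂ : ContinuousOn (fun ζ => Λ (w ζ)) K₂ := hΛc.comp hw.continuousOn h4
  have hK₁ : ContinuousOn (fun ζ => (Λ (w ζ)).2) K₁ := (hΛc.comp hw.continuousOn h1).snd
  have hg' : ContinuousOn (fun ζ => g ((Λ (w ζ)).1)) K₂ := hgc.comp hK₂.fst h5
  exact hK₂.snd.sub (hK₁.comp hg' fun z hz => hgS _ (h5 z hz))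

/-- Uniform convergence `d_k → c = (Λ ∘ v).2` on `T ⊆ K₂`, where
`d_k ζ := Q_n ζ - Q_n (g_k (P_n ζ))`, `n = k + N`: the first term converges to `c` uniformly on
`K₂`, and the correction `Q_n (g_k (P_n ζ))` is evaluated at a point of `K₁`, where `Q_n → 0`
uniformly. -/
theorem tendstoUniformlyOn_d {Λ : E4 → ℂ × ℂ} {u : ℕ → ℂ → E4} {v : ℂ → E4}
    {K₁ K₂ S T : Set ℂ} {N : ℕ} {g : ℕ → ℂ → ℂ}
    (hK₁ : TendstoUniformlyOn (fun n ζ => Λ (u n ζ)) (fun ζ => Λ (v ζ)) atTop K₁)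
    (hK₂ : TendstoUniformlyOn (fun n ζ => Λ (u n ζ)) (fun ζ => Λ (v ζ)) atTop K₂)
    (hflat : ∀ ζ ∈ K₁, (Λ (v ζ)).2 = 0) (hgS : ∀ k, ∀ y ∈ S, g k y ∈ K₁)
    (h5 : ∀ k, ∀ z ∈ K₂, (Λ (u (k + N) z)).1 ∈ S) (hT : T ⊆ K₂) :
    TendstoUniformlyOn
      (fun k ζ => (Λ (u (k + N) ζ)).2 - (Λ (u (k + N) (g k ((Λ (u (k + N) ζ)).1)))).2)
      (fun ζ => (Λ (v ζ)).2) atTop T := by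
  rw [Metric.tendstoUniformlyOn_iff]
  intro ε' hε'
  have e1 := (tendsto_add_atTop_nat N).eventually
    (Metric.tendstoUniformlyOn_iff.1 hK₁ (ε' / 2) (half_pos hε'))
  have e2 := (tendsto_add_atTop_nat N).eventually
    (Metric.tendstoUniformlyOn_iff.1 hK₂ (ε' / 2) (half_pos hε'))
  filter_upwards [e1, e2] with k hk1 hk2 ζ hζ
  have hζ' : g k ((Λ (u (k + N) ζ)).1) ∈ K₁ := hgS k _ (h5 k ζ (hT hζ))
  have hA : ‖(Λ (v ζ)).2 - (Λ (u (k + N) ζ)).2‖ < ε' / 2 := by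
    have h := hk2 ζ (hT hζ)
    rw [dist_eq_norm] at h
    calc ‖(Λ (v ζ)).2 - (Λ (u (k + N) ζ)).2‖ = ‖(Λ (v ζ) - Λ (u (k + N) ζ)).2‖ := by simp
      _ ≤ ‖Λ (v ζ) - Λ (u (k + N) ζ)‖ := norm_snd_le _
      _ < ε' / 2 := h
  have hB : ‖(Λ (u (k + N) (g k ((Λ (u (k + N) ζ)).1)))).2‖ < ε' / 2 := by
    have h := hk1 _ hζ'
    rw [dist_comm, dist_eq_norm] at h
    calc ‖(Λ (u (k + N) (g k ((Λ (u (k + N) ζ)).1)))).2‖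
        = ‖(Λ (u (k + N) (g k ((Λ (u (k + N) ζ)).1))) -
            Λ (v (g k ((Λ (u (k + N) ζ)).1)))).2‖ := by simp [hflat _ hζ']
      _ ≤ ‖Λ (u (k + N) (g k ((Λ (u (k + N) ζ)).1))) - Λ (v (g k ((Λ (u (k + N) ζ)).1)))‖ :=
          norm_snd_le _
      _ < ε' / 2 := h
  rw [dist_eq_norm]
  calc ‖(Λ (v ζ)).2 - ((Λ (u (k + N) ζ)).2 - (Λ (u (k + N) (g k ((Λ (u (k + N) ζ)).1)))).2)‖
      = ‖((Λ (v ζ)).2 - (Λ (u (k + N) ζ)).2) + (Λ (u (k + N) (g k ((Λ (u (k + N) ζ)).1)))).2‖ :=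
        by rw [sub_sub_eq_add_sub, add_sub_right_comm]
    _ ≤ ‖(Λ (v ζ)).2 - (Λ (u (k + N) ζ)).2‖ + ‖(Λ (u (k + N) (g k ((Λ (u (k + N) ζ)).1)))).2‖ :=
        norm_add_le _ _
    _ < ε' / 2 + ε' / 2 := add_lt_add hA hB
    _ = ε' := add_halves ε'

/-! ### Persistence: assembly -/

/-- (PL2) for abstract adapted data `(E, Λ, r, δ, B)` at `ξa`: with injective `C¹_loc`-approximants
the isolated alternative of the dichotomy is impossible, so the sheets coincide. -/
theorem coincideOfApprox {J : E4 → E4 →L[ℝ] E4} (hJs : ContDiff ℝ ∞ J) {v : ℂ → E4}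
    (hv : ContDiff ℝ ∞ v) (hvJ : IsJHolomorphicFlat J v) {E : ℂ × ℂ → E4} {Λ : E4 → ℂ × ℂ}
    {ξa ξb : ℂ} {r δ B : ℝ} (hE : ContDiff ℝ ∞ E) (hE0 : ∀ ζ : ℂ, E (ζ, 0) = v ζ)
    (hhol : ∀ ζ α β : ℂ, J (v ζ) (fderiv ℝ E (ζ, 0) (α, β)) =
      fderiv ℝ E (ζ, 0) (Complex.I * α, Complex.I * β))
    (hΛ : ContDiffOn ℝ ∞ Λ (ball (v ξa) δ))
    (hleft : ∀ p ∈ ball ((ξa, 0) : ℂ × ℂ) r, Λ (E p) = p)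
    (hright : ∀ x ∈ ball (v ξa) δ, Λ x ∈ ball ((ξa, 0) : ℂ × ℂ) r ∧ E (Λ x) = x)
    (hlow : ∀ p ∈ ball ((ξa, 0) : ℂ × ℂ) r, ∀ q : ℂ × ℂ, ‖q‖ ≤ B * ‖fderiv ℝ E p q‖)
    (hr : 0 < r) (hδ : 0 < δ) {u : ℕ → ℂ → E4} (hu : ∀ n, ContDiff ℝ ∞ (u n))
    (huinj : ∀ n, Function.Injective (u n)) (hloc : TendstoLocallyUniformly u v atTop)
    (hdloc : TendstoLocallyUniformly (fun n => fderiv ℝ (u n)) (fderiv ℝ v) atTop)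
    (hne : ξa ≠ ξb) (hx : v ξa = v ξb) :
    ∃ (σ : ℂ → ℂ) (N : Set ℂ), IsOpen N ∧ ξb ∈ N ∧ ContinuousOn σ N ∧
      (∀ ζ ∈ N, v ζ = v (σ ζ)) ∧ σ ξb = ξa := by
  have hcurve : ∀ ζ' : ℂ, ‖ζ' - ξa‖ < r → Λ (v ζ') = (ζ', 0) := fun ζ' h =>
    lambda_curve hE0 hleft h
  have hd0 : 0 < ‖ξa - ξb‖ := norm_pos_iff.2 (sub_ne_zero.2 hne)
  -- (a) the disc `K₁ = closedBall ξa r₁` about the first parameter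
  obtain ⟨r₁, hr₁, hr₁r, hr₁d, hK₁U⟩ : ∃ r₁ : ℝ, 0 < r₁ ∧ r₁ < r ∧ r₁ < ‖ξa - ξb‖ / 4 ∧
      ∀ ζ ∈ closedBall ξa r₁, v ζ ∈ ball (v ξa) δ := by
    obtain ⟨η, hη, hηv⟩ :=
      Metric.continuousAt_iff.1 (hv.continuous.continuousAt (x := ξa)) δ hδ
    refine ⟨min (η / 2) (min (r / 2) (‖ξa - ξb‖ / 8)),
      lt_min (half_pos hη) (lt_min (half_pos hr) (by positivity)), ?_, ?_, fun ζ hζ => ?_⟩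
    · exact (min_le_right _ _).trans_lt ((min_le_left _ _).trans_lt (half_lt_self hr))
    · exact (min_le_right _ _).trans_lt ((min_le_right _ _).trans_lt (by linarith))
    · exact hηv ((mem_closedBall.1 hζ).trans_lt ((min_le_left _ _).trans_lt (half_lt_self hη)))
  have hflat : ∀ ζ ∈ closedBall ξa r₁,
      (fun ζ => Λ (v ζ)) =ᶠ[𝓝 ζ] ⇑(ContinuousLinearMap.inl ℝ ℂ ℂ) := fun ζ hζ => by
    have hζr : ζ ∈ ball ξa r := mem_ball.2 ((mem_closedBall.1 hζ).trans_lt hr₁r)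
    filter_upwards [isOpen_ball.mem_nhds hζr] with ζ' hζ'
    rw [ContinuousLinearMap.inl_apply]
    exact hcurve ζ' (mem_ball_iff_norm.1 hζ')
  -- (b, c) the first sheet of the approximants is a graph over `K₁`; `C⁰`-convergence on `K₁`
  have hG := eventually_graph isOpen_ball hΛ hu hv hloc hdloc hr₁ hK₁U hflat
  obtain ⟨hT1, -, -⟩ := helper_composeC1Convergence Λ _ isOpen_ball hΛ u v hu hv hloc hdloc
    (closedBall ξa r₁) (isCompact_closedBall ξa r₁) hK₁U
  -- (d) the radius `ρ₀` about the second parameter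
  obtain ⟨ρ₀, hρ₀, hρ₀d, hmaps, haρ₀⟩ : ∃ ρ₀ : ℝ, 0 < ρ₀ ∧ ρ₀ ≤ ‖ξa - ξb‖ / 4 ∧
      (∀ ζ ∈ ball ξb ρ₀, v ζ ∈ ball (v ξa) δ) ∧
      ∀ ζ ∈ ball ξb ρ₀, ‖(Λ (v ζ)).1 - ξa‖ < r₁ / 8 := by
    have hvb : v ξb ∈ ball (v ξa) δ := by
      rw [← hx]
      exact mem_ball_self hδ
    have hΛb : Λ (v ξb) = (ξa, 0) := by
      rw [← hx]
      exact hcurve ξa (by simpa using hr)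
    have e1 : ∀ᶠ ζ in 𝓝 ξb, v ζ ∈ ball (v ξa) δ :=
      hv.continuous.continuousAt.eventually_mem (isOpen_ball.mem_nhds hvb)
    have hcont : ContinuousAt (fun ζ => Λ (v ζ)) ξb :=
      (hΛ.continuousOn.continuousAt (isOpen_ball.mem_nhds hvb)).comp hv.continuous.continuousAt
    have e2 : ∀ᶠ ζ in 𝓝 ξb, Λ (v ζ) ∈ ball ((ξa, 0) : ℂ × ℂ) (r₁ / 8) :=
      hcont.eventually_mem (isOpen_ball.mem_nhds (by
        rw [hΛb]
        exact mem_ball_self (by positivity)))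
    obtain ⟨τ, hτ, hτp⟩ := Metric.eventually_nhds_iff.1 (e1.and e2)
    refine ⟨min τ (‖ξa - ξb‖ / 4), lt_min hτ (by positivity), min_le_right _ _,
      fun ζ hζ => (hτp (lt_of_lt_of_le (mem_ball.1 hζ) (min_le_left _ _))).1,
      fun ζ hζ => ?_⟩
    have h : Λ (v ζ) ∈ ball ((ξa, 0) : ℂ × ℂ) (r₁ / 8) :=
      (hτp (lt_of_lt_of_le (mem_ball.1 hζ) (min_le_left _ _))).2
    rw [mem_ball, dist_eq_norm] at h
    calc ‖(Λ (v ζ)).1 - ξa‖ = ‖(Λ (v ζ) - (ξa, 0)).1‖ := by simp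
      _ ≤ ‖Λ (v ζ) - (ξa, 0)‖ := norm_fst_le _
      _ < r₁ / 8 := h
  -- the dichotomy at `ξb` for this radius
  have hac : ∀ ζ : ℂ, Λ (v ζ) = ((fun ζ => (Λ (v ζ)).1) ζ, (fun ζ => (Λ (v ζ)).2) ζ) :=
    fun ζ => rfl
  obtain ⟨ρ, -, hρρ₀, hdich⟩ :=
    dichotomy hJs hv hvJ hE hE0 hhol hΛ hleft hright hlow hr hx hρ₀ hmaps hac
  obtain ⟨ha, hc, -, -, -, hab, -⟩ := sheet hv hvJ hE0 hΛ hleft hright hr hx hmaps hac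
  rcases hdich with hev | ⟨ε, hε, hερ, hzf, hwind⟩
  · exact coincide_of_eventually hE0 hright hρ₀ hmaps hac ha.continuousOn hab hev
  exfalso
  -- (e) the disc `K₂ = closedBall ξb ε` about the second parameter
  have hK₂ρ₀ : closedBall ξb ε ⊆ ball ξb ρ₀ := closedBall_subset_ball (by linarith)
  have hK₂U : ∀ ζ ∈ closedBall ξb ε, v ζ ∈ ball (v ξa) δ := fun ζ hζ => hmaps ζ (hK₂ρ₀ hζ)
  obtain ⟨hT2, hS⟩ := eventually_sheetTwo isOpen_ball hΛ hu hv hloc hdloc hr₁ hK₂U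
    fun ζ hζ => haρ₀ ζ (hK₂ρ₀ hζ)
  -- (f) beyond `N` everything holds: right inverses `g k` and the functions `d k`, `n = k + N`
  obtain ⟨N, hN⟩ := eventually_atTop.1 (hG.and hS)
  have hN' : ∀ k : ℕ, ∃ g : ℂ → ℂ, (∀ ζ ∈ closedBall ξa r₁, u (k + N) ζ ∈ ball (v ξa) δ) ∧
      (∀ y ∈ closedBall ξa (r₁ / 4), g y ∈ closedBall ξa r₁ ∧ (Λ (u (k + N) (g y))).1 = y) ∧
      ContinuousOn g (closedBall ξa (r₁ / 4)) ∧
      (∀ ζ ∈ closedBall ξb ε, u (k + N) ζ ∈ ball (v ξa) δ) ∧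
      ∀ ζ ∈ closedBall ξb ε, (Λ (u (k + N) ζ)).1 ∈ closedBall ξa (r₁ / 4) := fun k => by
    obtain ⟨⟨h1, g, hg, hgc⟩, h4, h5⟩ := hN (k + N) (Nat.le_add_left N k)
    exact ⟨g, h1, hg, hgc, h4, h5⟩
  choose g h1 hg hgc h4 h5 using hN'
  obtain ⟨d, hd⟩ : ∃ d : ℕ → ℂ → ℂ, ∀ k ζ, d k ζ =
      (Λ (u (k + N) ζ)).2 - (Λ (u (k + N) (g k ((Λ (u (k + N) ζ)).1)))).2 :=
    ⟨_, fun _ _ => rfl⟩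
  have hdcont : ∀ k, ContinuousOn (d k) (closedBall ξb ε) := fun k =>
    (continuousOn_d hΛ.continuousOn (hu (k + N)).continuous (h1 k) (h4 k)
      (fun y hy => (hg k y hy).1) (hgc k) (h5 k)).congr fun ζ _ => hd k ζ
  have hdconv : TendstoUniformlyOn d (fun ζ => (Λ (v ζ)).2) atTop (sphere ξb ε) := by
    refine (tendstoUniformlyOn_d hT1 hT2 (fun ζ hζ => ?_) (fun k y hy => (hg k y hy).1) h5
      sphere_subset_closedBall).congr (Eventually.of_forall fun k ζ _ => (hd k ζ).symm)
    rw [hcurve ζ ((mem_closedBall_iff_norm.1 hζ).trans_lt hr₁r)]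
  -- (g) zeros persist: some `d k` vanishes somewhere in `K₂`
  have hcs : ContinuousOn (fun ζ => (Λ (v ζ)).2) (sphere ξb ε) :=
    hc.continuousOn.mono (sphere_subset_closedBall.trans hK₂ρ₀)
  have hcne : ∀ z ∈ sphere ξb ε, (fun ζ => (Λ (v ζ)).2) z ≠ 0 := fun z hz =>
    hzf z (by rw [mem_sphere_iff_norm.1 hz]; exact hε) (mem_sphere_iff_norm.1 hz).le
  obtain ⟨k, z, hzK, hz0⟩ :=
    (helper_zerosPersist (fun ζ => (Λ (v ζ)).2) d ξb ε hε hcs hcne hwind hdcont hdconv).exists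
  -- two distinct parameters with the same `u (k + N)`-image
  rw [hd] at hz0
  obtain ⟨hζ'K, hPζ'⟩ := hg k _ (h5 k z hzK)
  have hΛeq : Λ (u (k + N) z) = Λ (u (k + N) (g k ((Λ (u (k + N) z)).1))) :=
    Prod.ext hPζ'.symm (sub_eq_zero.1 hz0)
  have hzeq : z = g k ((Λ (u (k + N) z)).1) :=
    huinj (k + N) (lambda_injOn hright (h4 k z hzK) (h1 k _ hζ'K) hΛeq)
  have hz1 : ‖z - ξb‖ ≤ ε := mem_closedBall_iff_norm.1 hzK
  have hz2 : ‖g k ((Λ (u (k + N) z)).1) - ξa‖ ≤ r₁ := mem_closedBall_iff_norm.1 hζ'K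
  rw [← hzeq] at hz2
  have h3 := norm_sub_le_norm_sub_add_norm_sub ξa z ξb
  rw [norm_sub_rev ξa z] at h3
  linarith

end PairCoincide

/-- (PL2) persistence: if the immersed curve is a `C¹_loc`-limit of INJECTIVE smooth curves, an
isolated intersection of two of its sheets at distinct parameters is impossible, so the sheets
coincide. -/
theorem helper_pairCoincideOfApprox (J : E4 → E4 →L[ℝ] E4) (hJs : ContDiff ℝ ∞ J)
    (hJ2 : ∀ x v, J x (J x v) = -v) (v : ℂ → E4) (hv : ContDiff ℝ ∞ v)
    (hvJ : IsJHolomorphicFlat J v) (himm : ∀ ξ : ℂ, Function.Injective (fderiv ℝ v ξ))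
    (u : ℕ → ℂ → E4) (hu : ∀ n, ContDiff ℝ ∞ (u n)) (huinj : ∀ n, Function.Injective (u n))
    (hloc : TendstoLocallyUniformly u v atTop)
    (hdloc : TendstoLocallyUniformly (fun n => fderiv ℝ (u n)) (fderiv ℝ v) atTop) :
    ∀ ξa ξb : ℂ, ξa ≠ ξb → v ξa = v ξb →
      ∃ (σ : ℂ → ℂ) (N : Set ℂ), IsOpen N ∧ ξb ∈ N ∧ ContinuousOn σ N ∧
        (∀ ζ ∈ N, v ζ = v (σ ζ)) ∧ σ ξb = ξa := by
  intro ξa ξb hne hx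
  obtain ⟨e, Λ, r, δ, B, hr, hδ, -, hΛ, hleft, hright, hlow⟩ :=
    helper_adaptedMapInverse J hJs hJ2 v hv hvJ ξa (himm ξa)
  obtain ⟨hE, hE0, hhol⟩ := helper_adaptedMapHol J hJs hJ2 v hv hvJ e
  exact PairCoincide.coincideOfApprox hJs hv hvJ hE hE0 hhol hΛ hleft hright hlow hr hδ hu
    huinj hloc hdloc hne hx

end Summit.SmoothPoincare4.SmoothPoincare4.Cruxes.TameOrBrodyR4.Sketch
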